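import Literature.AnabelianGeometry.EtaleTheta.ThetaSeriesPadicAlgCl
import HarnessLib

/-!
# [EtTh] Def. 1.9 / Thm. 1.10: the values of `Θ̈` at the `μ₄ · q̈^ℤ`-translates and their orders

Mochizuki, *The étale theta function and its Frobenioid-theoretic manifestations*, Publ. RIMS **45**
(2009), §1: Prop. 1.4 (ii) (PRIMS PDF p. 22 = printed p. 248), Def. 1.9 (i)(ii) and Thm. 1.10 (i)
(PDF pp. 29–30) [cite: MochizukiEtTh2009, Def 1.9 (ii) p.29]. Layer L2 of the abc-iut cell; proof-only
support file for row **K2/r7** of the sub-DAG `plan/L2/SUBDAG-EtTh-Thm110.md` (holder abc-iut-w5-d140;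
L2-lead ROW «abc-iut-L2-t6 K2/r7» 2026-08-26T01:43Z), seat abc-iut-L2-t6. No definitions, no named
facts; everything is about VALUES of the series `Θ̈ = thetaDdot q̈` (abc-iut-L2-t1, `ClassicalTheta.lean`)
— the class-level statements of Thm. 1.10 stay in the holder's statements file (cf. abc-iut-L2-t1's
caution V1/V2, INBOX 2026-08-26T01:45Z: the §1 interface does not tie `evalAt` to the coordinate).

Def. 1.9 (p. 255): a *standard set of values* of `η̈^{Θ,ℤ}` is the set of values at `τ` (or at `τ⁻¹`) —
the points with `Ü(τ^{±1}) = (√−1)^{±1}` — of the classes in the `ℤ`-orbit `η̈^{Θ,ℤ}`; by Prop. 1.4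
(ii)/(iii) these values are the numbers `Θ̈(q̈^a · ζ)`, `a ∈ ℤ`, `ζ = ±√−1`, up to the constant multiple
carried by the class; "of standard type" asks that "the unique value … of maximal order [i.e., relative
to the valuation on `K`] of some standard set of values … is equal to `±1`". This file supplies the
`q̈`-adic ORDER computation behind "the unique value of maximal order":

* `thetaDdot_zpow_mul_of_sq_eq_neg_one` — **Prop. 1.4 (ii) at the value level**: for `ζ² = −1`,
  `q̈ ≠ 0`, `a ∈ ℤ`: `Θ̈(q̈^a ζ) = q̈^{−a²} Θ̈(ζ)` (the factors `(−1)^a` and `ζ^{−2a} = (−1)^a` of the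
  functional equation cancel), and `Θ̈(q̈^a (−ζ)) = −q̈^{−a²} Θ̈(ζ)` — any normed field, no convergence
  hypothesis (cf. the [IUTchII]-side form `Literature.IUT.HodgeArakelov.thetaDdot_sqrt_neg_one_mul_zpow`,
  stated as `Θ̈(i q̈^j)`; not imported here);
* `norm_thetaDdot_zpow_mul_of_sq_eq_neg_one` — `‖Θ̈(q̈^a (±ζ))‖ = ‖q̈‖^{−a²} ‖Θ̈(ζ)‖`; hence, for
  `0 < ‖q̈‖ < 1` and `Θ̈(ζ) ≠ 0` (i.e. `2 ≠ 0`): `‖Θ̈(ζ)‖ < ‖Θ̈(q̈^a ζ)‖` for `a ≠ 0`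
  (`norm_thetaDdot_lt_norm_thetaDdot_zpow_mul`), `‖Θ̈(q̈^a ζ)‖ ≤ ‖Θ̈(ζ)‖ ↔ a = 0`
  (`norm_thetaDdot_zpow_mul_le_iff`), and `‖Θ̈(q̈^a ζ)‖ = ‖Θ̈(q̈^b ζ)‖ ↔ |a| = |b|`
  (`norm_thetaDdot_zpow_mul_eq_iff`) — **the value of maximal order (= minimal absolute value) among the
  `Θ̈(q̈^a · (±ζ))` is attained exactly at `a = 0`, where it is `±Θ̈(ζ)`** (`norm_thetaDdot_le_of_mem_values`
  / `eq_zero_of_norm_le_of_mem_values`);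
* over a complete ultrametric field and in `ℚ̄_p = PadicAlgCl p` (the carrier on which the §1 interface
  `MuTwoSetting.IsOfStandardType` compares absolute values), with `‖Θ̈(√−1)‖ = ‖2‖`
  (`ClassicalThetaRawValue.norm_thetaDdot_sqrt_neg_one`, `ThetaSeriesPadicAlgCl`): the closed form
  **`‖Θ̈(q̈^a (±ζ))‖ = ‖q̈‖^{−a²} ‖2‖`** (`norm_thetaDdot_zpow_mul_sqrt_neg_one`,
  `PadicAlgCl.norm_thetaDdot_zpow_mul_sqrt_neg_one`), the unit clause "for `‖2‖ = 1`, `Θ̈(q̈^a ζ)` is a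
  unit iff `a = 0`" (`norm_thetaDdot_zpow_mul_le_one_iff`; in `ℚ̄_p`: `…_of_ne_two` for `p ≠ 2`, while for
  `p = 2` even the value of maximal order has `‖Θ̈(√−1)‖ = ‖2‖ < 1`), and the INJECTIVITY of the absolute
  value on each standard set of values (`injOn_norm_thetaDdot_values`) together with the symmetry
  `τ ↔ τ⁻¹` (`thetaDdot_values_neg_eq`) — the analytic content of the K2 rows r8 (b₁)/(b₂)
  (`StandardValuesNormInjective` / `StandardValuesInvSymm` of `ConstantMultipleRigiditySub.lean`);
* the arithmetic of "`= ±1`" under rescaling by a constant `u` (Thm. 1.10 (i): "determines this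
  collection of classes up to multiplication by `±1`"): `eq_or_eq_neg_of_mul_sign` — if `v = ±1` and
  `u v = ±1` then `u = ±1`.

Classical and undisputed (`q̈`-adic bookkeeping of Prop. 1.4 (ii)); HONEST FRAMING: nothing here takes a
side on any disputed claim of the IUT corpus; typed ≠ endorsed.
-/

noncomputable section

namespace Literature.AnabelianGeometry.EtaleTheta

open IsUltrametricDist

/-! ### The values `Θ̈(q̈^a · ζ)`, `ζ² = −1`, in any normed field -/

section AnyField

variable {𝕜 : Type*} [NormedField 𝕜] {q2 ζ : 𝕜}

/-- `ζ² = −1 ⇒ ζ ≠ 0`. [folklore] -/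
private theorem ne_zero_of_sq_eq_neg_one (hζ : ζ ^ 2 = -1) : ζ ≠ 0 := by
  rintro rfl
  norm_num at hζ

/-- `ζ² = −1 ⇒ (−ζ)² = −1`. [folklore] -/
private theorem neg_sq_eq_neg_one (hζ : ζ ^ 2 = -1) : (-ζ) ^ 2 = -1 := by
  rw [neg_sq, hζ]

/-- The sign bookkeeping of Prop. 1.4 (ii) at `Ü = ζ`, `ζ² = −1`: `(−1)^a · ζ^{−2a} = 1`.
[cite: MochizukiEtTh2009, Prop 1.4 (ii) p.22] -/
private theorem negOnePow_mul_zpow_eq_one (hζ : ζ ^ 2 = -1) (a : ℤ) :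
    ((a.negOnePow : ℤ) : 𝕜) * ζ ^ (-(2 * a)) = 1 := by
  have hζ0 : ζ ≠ 0 := ne_zero_of_sq_eq_neg_one hζ
  have h1 : ζ ^ (-(2 * a)) = (-1 : 𝕜) ^ (-a) := by
    rw [show -(2 * a) = 2 * (-a) by ring, zpow_mul, zpow_ofNat, hζ]
  rw [Int.cast_negOnePow, h1, ← zpow_add₀ (neg_ne_zero.mpr one_ne_zero), add_neg_cancel, zpow_zero]

/-- **Prop. 1.4 (ii) at the value level**: for `ζ² = −1`, `q̈ ≠ 0` and `a ∈ ℤ`,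
`Θ̈(q̈^a · ζ) = q̈^{−a²} · Θ̈(ζ)` — the values at `τ` of the `ℤ`-translates (Def. 1.9 (i)) are the
`q̈^{−a²}`-multiples of `Θ̈(√−1)`. [cite: MochizukiEtTh2009, Prop 1.4 (ii) p.22] -/
theorem thetaDdot_zpow_mul_of_sq_eq_neg_one (hζ : ζ ^ 2 = -1) (hq0 : q2 ≠ 0) (a : ℤ) :
    thetaDdot q2 (q2 ^ a * ζ) = q2 ^ (-(a * a)) * thetaDdot q2 ζ := by
  rw [thetaDdot_zpow_mul hq0 (ne_zero_of_sq_eq_neg_one hζ) a,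
    show ((a.negOnePow : ℤ) : 𝕜) * q2 ^ (-(a * a)) * ζ ^ (-(2 * a)) * thetaDdot q2 ζ =
      (((a.negOnePow : ℤ) : 𝕜) * ζ ^ (-(2 * a))) * (q2 ^ (-(a * a)) * thetaDdot q2 ζ) by ring,
    negOnePow_mul_zpow_eq_one hζ, one_mul]

/-- The companion point `τ⁻¹` (`Ü = −ζ = ζ⁻¹`): `Θ̈(q̈^a · (−ζ)) = −q̈^{−a²} · Θ̈(ζ)` (`Θ̈` is odd).
[cite: MochizukiEtTh2009, Prop 1.4 (ii) p.22] -/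
theorem thetaDdot_zpow_mul_neg_of_sq_eq_neg_one (hζ : ζ ^ 2 = -1) (hq0 : q2 ≠ 0) (a : ℤ) :
    thetaDdot q2 (q2 ^ a * -ζ) = -(q2 ^ (-(a * a)) * thetaDdot q2 ζ) := by
  rw [thetaDdot_zpow_mul_of_sq_eq_neg_one (neg_sq_eq_neg_one hζ) hq0 a, thetaDdot_neg, mul_neg]

/-- `ζ⁻¹ = −ζ` for `ζ² = −1` (so `τ⁻¹`, with coordinate `(√−1)⁻¹`, is the point `Ü = −√−1`).
[cite: MochizukiEtTh2009, Def 1.9 (i) p.29] -/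
theorem inv_eq_neg_of_sq_eq_neg_one (hζ : ζ ^ 2 = -1) : ζ⁻¹ = -ζ := by
  have hζ0 : ζ ≠ 0 := ne_zero_of_sq_eq_neg_one hζ
  have h : ζ * (-ζ) = 1 := by linear_combination -hζ
  exact inv_eq_of_mul_eq_one_right h

/-- **Absolute values of the translates**: `‖Θ̈(q̈^a · ζ)‖ = ‖q̈‖^{−a²} · ‖Θ̈(ζ)‖` (`ζ² = −1`, `q̈ ≠ 0`).
[cite: MochizukiEtTh2009, Def 1.9 (ii) p.29] -/
theorem norm_thetaDdot_zpow_mul_of_sq_eq_neg_one (hζ : ζ ^ 2 = -1) (hq0 : q2 ≠ 0) (a : ℤ) :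
    ‖thetaDdot q2 (q2 ^ a * ζ)‖ = ‖q2‖ ^ (-(a * a)) * ‖thetaDdot q2 ζ‖ := by
  rw [thetaDdot_zpow_mul_of_sq_eq_neg_one hζ hq0 a, norm_mul, norm_zpow]

/-- The same absolute value at the companion point: `‖Θ̈(q̈^a · (−ζ))‖ = ‖q̈‖^{−a²} · ‖Θ̈(ζ)‖`.
[cite: MochizukiEtTh2009, Def 1.9 (ii) p.29] -/
theorem norm_thetaDdot_zpow_mul_neg_of_sq_eq_neg_one (hζ : ζ ^ 2 = -1) (hq0 : q2 ≠ 0) (a : ℤ) :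
    ‖thetaDdot q2 (q2 ^ a * -ζ)‖ = ‖q2‖ ^ (-(a * a)) * ‖thetaDdot q2 ζ‖ := by
  rw [thetaDdot_zpow_mul_neg_of_sq_eq_neg_one hζ hq0 a, norm_neg, norm_mul, norm_zpow]

/-- For `0 < ‖q̈‖ < 1` and `a ≠ 0`: `1 < ‖q̈‖^{−a²}`. [folklore] -/
private theorem one_lt_norm_zpow_neg_sq (hq : ‖q2‖ < 1) (hq0 : q2 ≠ 0) {a : ℤ} (ha : a ≠ 0) :
    1 < ‖q2‖ ^ (-(a * a)) := by
  have hpos : 0 < ‖q2‖ := norm_pos_iff.mpr hq0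
  have hlt : -(a * a) < 0 := by nlinarith [mul_self_pos.mpr ha]
  exact one_lt_zpow_of_neg₀ hpos hq hlt

/-- For `0 < ‖q̈‖ < 1`: `1 ≤ ‖q̈‖^{−a²}`. [folklore] -/
private theorem one_le_norm_zpow_neg_sq (hq : ‖q2‖ < 1) (hq0 : q2 ≠ 0) (a : ℤ) :
    1 ≤ ‖q2‖ ^ (-(a * a)) := by
  by_cases ha : a = 0
  · simp [ha]
  · exact (one_lt_norm_zpow_neg_sq hq hq0 ha).le

/-- **Every translate has absolute value at least that of `Θ̈(ζ)`**: `‖Θ̈(ζ)‖ ≤ ‖Θ̈(q̈^a · ζ)‖`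
(`0 < ‖q̈‖ < 1`) — `Θ̈(√−1)` has MAXIMAL ORDER among the values. [cite: MochizukiEtTh2009, Def 1.9 (ii) p.29] -/
theorem norm_thetaDdot_le_norm_thetaDdot_zpow_mul (hζ : ζ ^ 2 = -1) (hq : ‖q2‖ < 1) (hq0 : q2 ≠ 0)
    (a : ℤ) : ‖thetaDdot q2 ζ‖ ≤ ‖thetaDdot q2 (q2 ^ a * ζ)‖ := by
  rw [norm_thetaDdot_zpow_mul_of_sq_eq_neg_one hζ hq0 a]
  exact le_mul_of_one_le_left (norm_nonneg _) (one_le_norm_zpow_neg_sq hq hq0 a)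

/-- **Strictly**: for `a ≠ 0` and `Θ̈(ζ) ≠ 0` (i.e. `2 ≠ 0`), `‖Θ̈(ζ)‖ < ‖Θ̈(q̈^a · ζ)‖`.
[cite: MochizukiEtTh2009, Def 1.9 (ii) p.29] -/
theorem norm_thetaDdot_lt_norm_thetaDdot_zpow_mul (hζ : ζ ^ 2 = -1) (hq : ‖q2‖ < 1) (hq0 : q2 ≠ 0)
    (h0 : thetaDdot q2 ζ ≠ 0) {a : ℤ} (ha : a ≠ 0) :
    ‖thetaDdot q2 ζ‖ < ‖thetaDdot q2 (q2 ^ a * ζ)‖ := by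
  rw [norm_thetaDdot_zpow_mul_of_sq_eq_neg_one hζ hq0 a]
  exact lt_mul_of_one_lt_left (norm_pos_iff.mpr h0) (one_lt_norm_zpow_neg_sq hq hq0 ha)

/-- **Uniqueness of the value of maximal order**: `‖Θ̈(q̈^a · ζ)‖ ≤ ‖Θ̈(ζ)‖ ↔ a = 0` (`0 < ‖q̈‖ < 1`,
`Θ̈(ζ) ≠ 0`). [cite: MochizukiEtTh2009, Def 1.9 (ii) p.29] -/
theorem norm_thetaDdot_zpow_mul_le_iff (hζ : ζ ^ 2 = -1) (hq : ‖q2‖ < 1) (hq0 : q2 ≠ 0)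
    (h0 : thetaDdot q2 ζ ≠ 0) {a : ℤ} :
    ‖thetaDdot q2 (q2 ^ a * ζ)‖ ≤ ‖thetaDdot q2 ζ‖ ↔ a = 0 := by
  refine ⟨fun h => ?_, fun h => by simp [h]⟩
  by_contra ha
  exact absurd h (not_le.mpr (norm_thetaDdot_lt_norm_thetaDdot_zpow_mul hζ hq hq0 h0 ha))

/-- Two translates have the same absolute value iff `|a| = |b|`: `‖Θ̈(q̈^a ζ)‖ = ‖Θ̈(q̈^b ζ)‖ ↔ |a| = |b|`
(`0 < ‖q̈‖ < 1`, `Θ̈(ζ) ≠ 0`). [cite: MochizukiEtTh2009, Def 1.9 (ii) p.29] -/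
theorem norm_thetaDdot_zpow_mul_eq_iff (hζ : ζ ^ 2 = -1) (hq : ‖q2‖ < 1) (hq0 : q2 ≠ 0)
    (h0 : thetaDdot q2 ζ ≠ 0) {a b : ℤ} :
    ‖thetaDdot q2 (q2 ^ a * ζ)‖ = ‖thetaDdot q2 (q2 ^ b * ζ)‖ ↔ a.natAbs = b.natAbs := by
  have hpos : 0 < ‖q2‖ := norm_pos_iff.mpr hq0
  rw [norm_thetaDdot_zpow_mul_of_sq_eq_neg_one hζ hq0 a, norm_thetaDdot_zpow_mul_of_sq_eq_neg_one hζ hq0 b,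
    mul_left_inj' (norm_ne_zero_iff.mpr h0), (zpow_right_strictAnti₀ hpos hq).injective.eq_iff,
    neg_inj, Int.natAbs_eq_natAbs_iff]
  exact mul_self_eq_mul_self_iff

/-- **The standard sets of values, concretely**: every value `Θ̈(q̈^a · s)` with `s = ±ζ` has absolute
value `≥ ‖Θ̈(ζ)‖`, i.e. `±Θ̈(√−1)` realise the maximal order of both standard sets of values.
[cite: MochizukiEtTh2009, Def 1.9 (ii) p.29] -/
theorem norm_thetaDdot_le_of_mem_values (hζ : ζ ^ 2 = -1) (hq : ‖q2‖ < 1) (hq0 : q2 ≠ 0) {v : 𝕜}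
    (hv : ∃ a : ℤ, v = thetaDdot q2 (q2 ^ a * ζ) ∨ v = thetaDdot q2 (q2 ^ a * -ζ)) :
    ‖thetaDdot q2 ζ‖ ≤ ‖v‖ := by
  obtain ⟨a, rfl | rfl⟩ := hv
  · exact norm_thetaDdot_le_norm_thetaDdot_zpow_mul hζ hq hq0 a
  · rw [norm_thetaDdot_zpow_mul_neg_of_sq_eq_neg_one hζ hq0 a,
      ← norm_thetaDdot_zpow_mul_of_sq_eq_neg_one hζ hq0 a]
    exact norm_thetaDdot_le_norm_thetaDdot_zpow_mul hζ hq hq0 a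

/-- … and the maximal order is attained ONLY at `a = 0`: a value `Θ̈(q̈^a · (±ζ))` of absolute value
`≤ ‖Θ̈(ζ)‖` has `a = 0`, hence equals `±Θ̈(ζ)` (`Θ̈(ζ) ≠ 0`). [cite: MochizukiEtTh2009, Def 1.9 (ii) p.29] -/
theorem eq_zero_of_norm_le_of_mem_values (hζ : ζ ^ 2 = -1) (hq : ‖q2‖ < 1) (hq0 : q2 ≠ 0)
    (h0 : thetaDdot q2 ζ ≠ 0) {a : ℤ} {s : 𝕜} (hs : s = ζ ∨ s = -ζ)
    (hle : ‖thetaDdot q2 (q2 ^ a * s)‖ ≤ ‖thetaDdot q2 ζ‖) :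
    a = 0 ∧ (thetaDdot q2 (q2 ^ a * s) = thetaDdot q2 ζ ∨ thetaDdot q2 (q2 ^ a * s) = -thetaDdot q2 ζ) := by
  have ha : a = 0 := by
    rcases hs with rfl | rfl
    · exact (norm_thetaDdot_zpow_mul_le_iff hζ hq hq0 h0).mp hle
    · rw [norm_thetaDdot_zpow_mul_neg_of_sq_eq_neg_one hζ hq0 a,
        ← norm_thetaDdot_zpow_mul_of_sq_eq_neg_one hζ hq0 a] at hle
      exact (norm_thetaDdot_zpow_mul_le_iff hζ hq hq0 h0).mp hle
  refine ⟨ha, ?_⟩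
  subst ha
  rcases hs with rfl | rfl
  · left; simp
  · right; simp [thetaDdot_neg]

/-- The value `Θ̈(q̈^a · ζ)` depends only on `|a|` (indeed on `a²`). [cite: MochizukiEtTh2009, Prop 1.4 (ii) p.22] -/
theorem thetaDdot_zpow_mul_eq_of_natAbs_eq (hζ : ζ ^ 2 = -1) (hq0 : q2 ≠ 0) {a b : ℤ}
    (h : a.natAbs = b.natAbs) : thetaDdot q2 (q2 ^ a * ζ) = thetaDdot q2 (q2 ^ b * ζ) := by
  have hab : a * a = b * b := by
    rcases Int.natAbs_eq_natAbs_iff.mp h with rfl | rfl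
    · rfl
    · ring
  rw [thetaDdot_zpow_mul_of_sq_eq_neg_one hζ hq0 a, thetaDdot_zpow_mul_of_sq_eq_neg_one hζ hq0 b, hab]

/-- **«the UNIQUE value … of maximal order» as an injectivity statement** (the analytic content of the
K2 sub-DAG's row r8 (b₁) `StandardValuesNormInjective`): on the set of values
`{c · Θ̈(q̈^a · ζ) : a ∈ ℤ}` (`c ≠ 0` a fixed constant multiple, `0 < ‖q̈‖ < 1`, `Θ̈(ζ) ≠ 0`) the absolute
value is INJECTIVE — two values with the same absolute value have `|a| = |b|`, hence coincide.
[cite: MochizukiEtTh2009, Def 1.9 (ii) p.29] -/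
theorem injOn_norm_thetaDdot_values (hζ : ζ ^ 2 = -1) (hq : ‖q2‖ < 1) (hq0 : q2 ≠ 0)
    (h0 : thetaDdot q2 ζ ≠ 0) {c : 𝕜} (hc : c ≠ 0) :
    Set.InjOn (fun v : 𝕜 => ‖v‖) {v | ∃ a : ℤ, v = c * thetaDdot q2 (q2 ^ a * ζ)} := by
  rintro v ⟨a, rfl⟩ w ⟨b, rfl⟩ h
  have h' : ‖thetaDdot q2 (q2 ^ a * ζ)‖ = ‖thetaDdot q2 (q2 ^ b * ζ)‖ := by
    simp only [norm_mul] at h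
    exact mul_left_cancel₀ (norm_ne_zero_iff.mpr hc) h
  rw [thetaDdot_zpow_mul_eq_of_natAbs_eq hζ hq0 ((norm_thetaDdot_zpow_mul_eq_iff hζ hq hq0 h0).mp h')]

/-- **The values at `τ⁻¹` are the negatives of the values at `τ`** (the analytic content of the K2
sub-DAG's row r8 (b₂) `StandardValuesInvSymm`; `Θ̈(−Ü) = −Θ̈(Ü)`): as sets,
`{c · Θ̈(q̈^a · (−ζ))} = {−w : w ∈ {c · Θ̈(q̈^a · ζ)}}`. [cite: MochizukiEtTh2009, Prop 1.4 (ii) p.22] -/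
theorem thetaDdot_values_neg_eq (q2 ζ c : 𝕜) :
    {v : 𝕜 | ∃ a : ℤ, v = c * thetaDdot q2 (q2 ^ a * -ζ)} =
      {v | ∃ w ∈ {w : 𝕜 | ∃ a : ℤ, w = c * thetaDdot q2 (q2 ^ a * ζ)}, v = -w} := by
  ext v
  simp only [Set.mem_setOf_eq, mul_neg, thetaDdot_neg]
  constructor
  · rintro ⟨a, rfl⟩
    exact ⟨c * thetaDdot q2 (q2 ^ a * ζ), ⟨a, rfl⟩, by ring⟩
  · rintro ⟨w, ⟨a, rfl⟩, rfl⟩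
    exact ⟨a, by ring⟩

/-- Rescaling by a constant `u` (the classes `u · η̈`, `u ∈ O^×_K`): the values become `u · Θ̈(q̈^a · ζ)`,
with absolute values `‖u‖ · ‖q̈‖^{−a²} · ‖Θ̈(ζ)‖`; for `‖u‖ = 1` the orders are unchanged.
[cite: MochizukiEtTh2009, Thm 1.10 (i) p.29] -/
theorem norm_mul_thetaDdot_zpow_mul_of_norm_eq_one (hζ : ζ ^ 2 = -1) (hq0 : q2 ≠ 0) {u : 𝕜}
    (hu : ‖u‖ = 1) (a : ℤ) :
    ‖u * thetaDdot q2 (q2 ^ a * ζ)‖ = ‖q2‖ ^ (-(a * a)) * ‖thetaDdot q2 ζ‖ := by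
  rw [norm_mul, hu, one_mul, norm_thetaDdot_zpow_mul_of_sq_eq_neg_one hζ hq0 a]

/-- The arithmetic of "determines … up to multiplication by `±1`" (Thm. 1.10 (i)): if the maximal-order
value `v` of one class is `±1` and that of the rescaled class, `u · v`, is `±1` as well, then `u = ±1`.
[cite: MochizukiEtTh2009, Thm 1.10 (i) p.29] -/
theorem eq_or_eq_neg_of_mul_sign {R : Type*} [Ring R] [NoZeroDivisors R] {u v : R}
    (hv : v = 1 ∨ v = -1) (huv : u * v = 1 ∨ u * v = -1) : u = 1 ∨ u = -1 := by
  rcases hv with rfl | rfl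
  · simpa using huv
  · rw [mul_neg_one] at huv
    rcases huv with h | h
    · right; rw [← h, neg_neg]
    · left; exact neg_injective h

end AnyField

/-! ### Complete ultrametric fields: `‖Θ̈(q̈^a · (±ζ))‖ = ‖q̈‖^{−a²} ‖2‖` -/

section Ultrametric

variable {𝕜 : Type*} [NormedField 𝕜] [CompleteSpace 𝕜] [IsUltrametricDist 𝕜] {q2 ζ : 𝕜}

/-- **Closed form of the absolute values of the standard values** (complete ultrametric field,
`‖q̈‖ < 1`, `q̈ ≠ 0`, `ζ² = −1`): `‖Θ̈(q̈^a · ζ)‖ = ‖q̈‖^{−a²} · ‖2‖` (from `‖Θ̈(√−1)‖ = ‖2‖`,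
`ClassicalThetaRawValue.norm_thetaDdot_sqrt_neg_one`). [cite: MochizukiEtTh2009, Def 1.9 (ii) p.29] -/
theorem norm_thetaDdot_zpow_mul_sqrt_neg_one (hζ : ζ ^ 2 = -1) (hq : ‖q2‖ < 1) (hq0 : q2 ≠ 0) (a : ℤ) :
    ‖thetaDdot q2 (q2 ^ a * ζ)‖ = ‖q2‖ ^ (-(a * a)) * ‖(2 : 𝕜)‖ := by
  rw [norm_thetaDdot_zpow_mul_of_sq_eq_neg_one hζ hq0 a, norm_thetaDdot_sqrt_neg_one hζ hq]

/-- The same at the companion point `−ζ`. [cite: MochizukiEtTh2009, Def 1.9 (ii) p.29] -/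
theorem norm_thetaDdot_zpow_mul_neg_sqrt_neg_one (hζ : ζ ^ 2 = -1) (hq : ‖q2‖ < 1) (hq0 : q2 ≠ 0)
    (a : ℤ) : ‖thetaDdot q2 (q2 ^ a * -ζ)‖ = ‖q2‖ ^ (-(a * a)) * ‖(2 : 𝕜)‖ := by
  rw [norm_thetaDdot_zpow_mul_neg_of_sq_eq_neg_one hζ hq0 a, norm_thetaDdot_sqrt_neg_one hζ hq]

/-- `Θ̈(ζ) ≠ 0 ↔ 2 ≠ 0` (complete ultrametric field, `‖q̈‖ < 1`): in characteristic `2` the "points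
`√−1`" are the cusps `±1`. [cite: MochizukiEtTh2009, Def 1.9 (ii) p.29] -/
theorem thetaDdot_sqrt_neg_one_ne_zero_iff (hζ : ζ ^ 2 = -1) (hq : ‖q2‖ < 1) :
    thetaDdot q2 ζ ≠ 0 ↔ (2 : 𝕜) ≠ 0 := by
  rw [← norm_pos_iff, ← norm_pos_iff, norm_thetaDdot_sqrt_neg_one hζ hq]

/-- **Unit clause**: when `‖2‖ = 1` (odd residue characteristic), `Θ̈(q̈^a · ζ)` is a unit iff `a = 0`;
more precisely `‖Θ̈(q̈^a · ζ)‖ ≤ 1 ↔ a = 0`. [cite: MochizukiEtTh2009, Def 1.9 (ii) p.29] -/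
theorem norm_thetaDdot_zpow_mul_le_one_iff (hζ : ζ ^ 2 = -1) (hq : ‖q2‖ < 1) (hq0 : q2 ≠ 0)
    (h2 : ‖(2 : 𝕜)‖ = 1) {a : ℤ} : ‖thetaDdot q2 (q2 ^ a * ζ)‖ ≤ 1 ↔ a = 0 := by
  have h0 : thetaDdot q2 ζ ≠ 0 :=
    (thetaDdot_sqrt_neg_one_ne_zero_iff hζ hq).mpr (norm_pos_iff.mp (by rw [h2]; exact one_pos))
  rw [← norm_thetaDdot_zpow_mul_le_iff hζ hq hq0 h0, norm_thetaDdot_sqrt_neg_one hζ hq, h2]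

/-- With `‖2‖ = 1`: `‖Θ̈(q̈^a · ζ)‖ = 1 ↔ a = 0`. [cite: MochizukiEtTh2009, Def 1.9 (ii) p.29] -/
theorem norm_thetaDdot_zpow_mul_eq_one_iff (hζ : ζ ^ 2 = -1) (hq : ‖q2‖ < 1) (hq0 : q2 ≠ 0)
    (h2 : ‖(2 : 𝕜)‖ = 1) {a : ℤ} : ‖thetaDdot q2 (q2 ^ a * ζ)‖ = 1 ↔ a = 0 := by
  refine ⟨fun h => (norm_thetaDdot_zpow_mul_le_one_iff hζ hq hq0 h2).mp h.le, fun h => ?_⟩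
  rw [norm_thetaDdot_zpow_mul_sqrt_neg_one hζ hq hq0, h, h2]
  simp

end Ultrametric

/-! ### In `ℚ̄_p = PadicAlgCl p`, the carrier on which `MuTwoSetting.IsOfStandardType` compares values -/

namespace PadicAlgCl

variable {p : ℕ} [Fact p.Prime] {q2 ζ : PadicAlgCl p}

/-- **`‖Θ̈(q̈^a · ζ)‖ = ‖q̈‖^{−a²} · ‖2‖` in `ℚ̄_p`** (`‖q̈‖ < 1`, `q̈ ≠ 0`, `ζ² = −1`; no completeness
needed — `ThetaSeriesPadicAlgCl`). [cite: MochizukiEtTh2009, Def 1.9 (ii) p.29] -/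
theorem norm_thetaDdot_zpow_mul_sqrt_neg_one (hζ : ζ ^ 2 = -1) (hq : ‖q2‖ < 1) (hq0 : q2 ≠ 0)
    (a : ℤ) : ‖thetaDdot q2 (q2 ^ a * ζ)‖ = ‖q2‖ ^ (-(a * a)) * ‖(2 : PadicAlgCl p)‖ := by
  rw [norm_thetaDdot_zpow_mul_of_sq_eq_neg_one hζ hq0 a, PadicAlgCl.norm_thetaDdot_sqrt_neg_one hζ hq]

/-- The same at the companion point `−ζ`, in `ℚ̄_p`. [cite: MochizukiEtTh2009, Def 1.9 (ii) p.29] -/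
theorem norm_thetaDdot_zpow_mul_neg_sqrt_neg_one (hζ : ζ ^ 2 = -1) (hq : ‖q2‖ < 1) (hq0 : q2 ≠ 0)
    (a : ℤ) : ‖thetaDdot q2 (q2 ^ a * -ζ)‖ = ‖q2‖ ^ (-(a * a)) * ‖(2 : PadicAlgCl p)‖ := by
  rw [norm_thetaDdot_zpow_mul_neg_of_sq_eq_neg_one hζ hq0 a,
    PadicAlgCl.norm_thetaDdot_sqrt_neg_one hζ hq]

/-- In `ℚ̄_p` (characteristic `0`) `Θ̈(ζ) ≠ 0`. [cite: MochizukiEtTh2009, Def 1.9 (ii) p.29] -/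
theorem thetaDdot_sqrt_neg_one_ne_zero (hζ : ζ ^ 2 = -1) (hq : ‖q2‖ < 1) : thetaDdot q2 ζ ≠ 0 := by
  rw [← norm_pos_iff, PadicAlgCl.norm_thetaDdot_sqrt_neg_one hζ hq, norm_pos_iff]
  exact two_ne_zero

/-- **The unique value of maximal order, in `ℚ̄_p`**: `‖Θ̈(q̈^a · ζ)‖ ≤ ‖Θ̈(ζ)‖ ↔ a = 0` and
`‖Θ̈(ζ)‖ < ‖Θ̈(q̈^a · ζ)‖` for `a ≠ 0` — unconditionally (characteristic `0`).
[cite: MochizukiEtTh2009, Def 1.9 (ii) p.29] -/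
theorem norm_thetaDdot_zpow_mul_le_iff (hζ : ζ ^ 2 = -1) (hq : ‖q2‖ < 1) (hq0 : q2 ≠ 0) {a : ℤ} :
    ‖thetaDdot q2 (q2 ^ a * ζ)‖ ≤ ‖thetaDdot q2 ζ‖ ↔ a = 0 :=
  EtaleTheta.norm_thetaDdot_zpow_mul_le_iff hζ hq hq0 (thetaDdot_sqrt_neg_one_ne_zero hζ hq)

/-- `‖2‖ = 1` in `ℚ̄_p` for `p ≠ 2` (and `‖2‖ < 1` for `p = 2`, `ThetaSeriesPadicAlgCl`). [folklore] -/
private theorem norm_two_eq_one_of_ne_two (hp : p ≠ 2) : ‖(2 : PadicAlgCl p)‖ = 1 := by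
  have hle : ‖(2 : PadicAlgCl p)‖ ≤ 1 := by
    have := IsUltrametricDist.norm_natCast_le_one (PadicAlgCl p) 2
    simpa using this
  have hnlt : ¬ ‖(2 : PadicAlgCl p)‖ < 1 := fun h => hp (PadicAlgCl.norm_two_lt_one_iff.mp h)
  exact le_antisymm hle (not_lt.mp hnlt)

/-- **Unit clause in `ℚ̄_p`, odd residue characteristic** (the standing hypothesis of Def. 2.5): for
`p ≠ 2`, `‖Θ̈(q̈^a · ζ)‖ ≤ 1 ↔ a = 0` — the value of maximal order `±Θ̈(√−1)` is the ONLY value of the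
standard set lying in `O_K`, and it is a unit. [cite: MochizukiEtTh2009, Def 1.9 (ii) p.29] -/
theorem norm_thetaDdot_zpow_mul_le_one_iff_of_ne_two (hζ : ζ ^ 2 = -1) (hq : ‖q2‖ < 1) (hq0 : q2 ≠ 0)
    (hp : p ≠ 2) {a : ℤ} : ‖thetaDdot q2 (q2 ^ a * ζ)‖ ≤ 1 ↔ a = 0 := by
  rw [← norm_thetaDdot_zpow_mul_le_iff hζ hq hq0 (a := a), PadicAlgCl.norm_thetaDdot_sqrt_neg_one hζ hq,
    norm_two_eq_one_of_ne_two hp]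

/-- For `p ≠ 2`: `‖Θ̈(q̈^a · ζ)‖ = 1 ↔ a = 0`. [cite: MochizukiEtTh2009, Def 1.9 (ii) p.29] -/
theorem norm_thetaDdot_zpow_mul_eq_one_iff_of_ne_two (hζ : ζ ^ 2 = -1) (hq : ‖q2‖ < 1) (hq0 : q2 ≠ 0)
    (hp : p ≠ 2) {a : ℤ} : ‖thetaDdot q2 (q2 ^ a * ζ)‖ = 1 ↔ a = 0 := by
  refine ⟨fun h => (norm_thetaDdot_zpow_mul_le_one_iff_of_ne_two hζ hq hq0 hp).mp h.le, fun h => ?_⟩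
  rw [norm_thetaDdot_zpow_mul_sqrt_neg_one hζ hq hq0, h, norm_two_eq_one_of_ne_two hp]
  simp

/-- For `p = 2` the value of maximal order is NOT a unit: `‖Θ̈(ζ)‖ = ‖2‖ < 1` (so no class `u · η̈`,
`u ∈ O^×_K`, is of standard type — the author's Comments (vi) / Def. 2.5's odd residue characteristic).
[cite: MochizukiEtTh2009, Def 1.9 (ii) p.29] -/
theorem norm_thetaDdot_sqrt_neg_one_lt_one_of_two (hζ : ζ ^ 2 = -1) (hq : ‖q2‖ < 1) (hp : p = 2) :
    ‖thetaDdot q2 ζ‖ < 1 :=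
  (PadicAlgCl.norm_thetaDdot_sqrt_neg_one_lt_one_iff hζ hq).mpr hp

end PadicAlgCl

end Literature.AnabelianGeometry.EtaleTheta
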